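/-
Copyright (c) 2026. All rights reserved.
Released under Apache 2.0 license as described in the file LICENSE.
Authors: abc-iut cell, prover seat abc-iut-w5-d053 (gen 5; row «SB′-BRICK-B-TS» of abc-iut-L4-lead m133/m135 = the `TS` side of
brick B of abc-iut-w5-d144's COR510iv-SB′ closer spec; the `⊞` side is abc-iut-w5-d144's `LogFrobeniusMonoGenuineSubIotaOver.lean`),
over abc-iut-L4-t3's `IotaOverTS` schema, this seat's open-augmentation sub-model and abc-iut-f-101's `genuineOpen`.
-/
import Literature.AnabelianGeometry.AbsoluteAnabelian.LogFrobeniusIotaOver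
import Literature.AnabelianGeometry.AbsoluteAnabelian.LogFrobeniusMonoTelecoreGenuineOpen
import HarnessLib

/-!
# [AbsTopIII] Def 5.4 (vii), `TS`-half, at the genuine OPEN-AUGMENTATION carrier: the `TS`-valued homotopy datum and
# «the `ι_{v,ε}` lie over `Th•[Z]`» — brick B (`TS` side) of the Cor 5.10 (iv) s_b′ closer

S. Mochizuki, *Topics in absolute anabelian geometry III*, J. Math. Sci. Univ. Tokyo 22 (2015) [MochizukiAbsTopIII2015]; locators =
kurims manuscript pages (`paper:url-5493eb38cbb7`): Def 5.4 (iv) p. 127 («λ⊞_{v,ν} … that 'lie over' Th•[Z]»), Def 5.4 (vii) p. 128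
(«the arrow in the diagram of (iii) corresponding to ε determines a natural transformation ι⊞_{v,ε} (respectively, ι_{v,ε})»),
Cor 5.10 (iv)(a) p. 147 («(D•⊢≤5 ∪ D•≤6) ∪ {An⊢} admits a natural structure of core … lies over An⊢»).

## What this file proves (MODEL-LEVEL; two `def`s + proofs; no Prop fact)

abc-iut-w5-d144's closer spec for `Cor510MonoTelecoreObservablesCompatible` (Cor 5.10 (iv) clause (b′)) isolates the one
non-formal input (§1 there): every `ι⊞_{v,ε}` / `ι_{v,ε}` must lie OVER the core, i.e. have identity component on the underlying
theater — abc-iut-L4-t3's print-quoting hypothesis schemas `LogFrobeniusSetting.IotaOver` / `TSHomotopies.IotaOverTS`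
(`LogFrobeniusIotaOver.lean`; binder vocabulary of brick D confirmed by abc-iut-L4-lead m135: `(hιover : L.IotaOver)
(hιoverTS : T.IotaOverTS)`).  The `⊞` half at the sub-model settings is abc-iut-w5-d144's `nonarchGenuineMonoAnSub_iotaOver` /
`nonarchGenuineMonoAnPfOpen_iotaOver` (`LogFrobeniusMonoGenuineSubIotaOver.lean`, not restated here).  This file is the `TS` half,
which first needs a `TS`-valued homotopy datum at these carriers (none was in the tree):

* §1 the `TS`-valued homotopy datum of this seat's SUB-MODEL settings `nonarchGenuineMonoAnSub p P ψ` (every full subcategory `P`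
  of the MLF model, every mono-analytic container family `ψ`): `nonarchIotaTSSub` (all six arrows of Def 5.4 (iii) incl.
  `k̄^× ↪ k̄`, as `(𝟙, ι_ε ∘ P.ι)`), `nonarchIotaTSSub_toTS` (on `Γ⃗^⋉_v` it is `ι⊞ ▹ (𝒩⊞_v → 𝒩_v)`), ★ `nonarchGenuineMonoAnSubTS`, and
  ★ `genuineOpenTS p Vmod` := the case of abc-iut-f-101's `genuineOpen p Vmod` (`P = IsOpenAug`, `ψ = ψMonoPf`, all places
  nonarchimedean) — the `T` that bricks D / E and abc-iut-L4-t5's generic `…cor55ObservablesTS` instances consume at this carrier;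
* §2 ★ MODEL LEMMAS `nonarchGenuineMonoAnSubTS_iotaOverTS : (nonarchGenuineMonoAnSubTS p P ψ Vmod isArc).IotaOverTS` (first
  components of `(𝟙, ι_ε)` are identities; `lamOver`, `logOver`, `twistOver` of the model are identities) and
  ★ `genuineOpenTS_iotaOverTS : (genuineOpenTS p Vmod).IotaOverTS` (brick D's hypothesis (ιoverTS) at the genuine open-augmentation
  carrier); consequence by name: `genuineOpenTS_isIso_toE_iota` (abc-iut-L4-t3's `IotaOverTS.isIso_toE_iota`).

HONEST FRAMING: MODEL-LEVEL identities of base components; refereed pre-IUT material; nothing here bears on [IUTchIII] Cor. 3.12;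
no side taken; typed ≠ proved; instantiated ≠ endorsed.
-/

set_option autoImplicit false

universe u

open CategoryTheory

namespace Literature.AnabelianGeometry.AbsoluteAnabelian

namespace LogFrobeniusSetting

/-! ## §1. The `TS`-valued homotopy datum of the sub-model settings -/

section Sub

open AbsTopIII

variable (p : ℕ) [Fact p.Prime] (P : ObjectProperty (TFModel p))

/-- `TS`-valued `ι_{v,ε}` of the sub-model for ALL edges of `Γ⃗^log_v` (`𝒩⊞_v → 𝒩_v` is the identity in the model):
`(𝟙, ι_ε ∘ P.ι)`. [cite: MochizukiAbsTopIII2015, Definition 5.4 (vii) p.128] -/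
noncomputable def nonarchIotaTSSub (b : Bool) {ν₁ ν₂ : LogVertex b} (ε : LogEdgeTS b ν₁ ν₂) :
    (frobeniusTwist (𝟭 (Up P.FullSubcategory)) ν₁.isPostLog ⋙ nonarchLamSub p P b ν₁) ⋙
        𝟭 (Up (P.FullSubcategory × TSObj)) ⟶
      nonarchLamSub p P b ν₂ ⋙ 𝟭 (Up (P.FullSubcategory × TSObj)) :=
  eqToHom (by rw [frobeniusTwist_id_comp_sub]) ≫ Functor.whiskerRight (nonarchIotaCoreSub p P b ε) (𝟭 _)

/-- Whiskering a canonical identification is the canonical identification.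
[cite: MochizukiAbsTopIII2015, Definition 5.4 (vii) p.128] -/
theorem whiskerRight_eqToHom_functor_id {C D : Type*} [Category C] [Category D] {G G' : C ⥤ D} (h : G = G') :
    Functor.whiskerRight (eqToHom h) (𝟭 D) = eqToHom (by rw [h]) := by
  subst h
  simp [Functor.whiskerRight_id']

/-- On `Γ⃗^⋉_v` the `TS`-valued homotopy is `ι⊞` composed with `𝒩⊞_v → 𝒩_v` (Def 5.4 (vii)).
[cite: MochizukiAbsTopIII2015, Definition 5.4 (vii) p.128] -/
theorem nonarchIotaTSSub_toTS (b : Bool) {ν₁ ν₂ : LogVertex b} (ε : LogEdge b ν₁ ν₂) :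
    nonarchIotaTSSub p P b ε.toTS =
      Functor.whiskerRight (nonarchIotaSub p P b ε) (𝟭 (Up (P.FullSubcategory × TSObj))) := by
  simp only [nonarchIotaTSSub, nonarchIotaSub, Functor.whiskerRight_comp, whiskerRight_eqToHom_functor_id]

variable (ψ : (b : Bool) → LogVertex b → (MLFClosure.AnMono ⥤ MLFClosure.MonoBase × TSObj))
  (Vmod : Type 1) (isArc : Vmod → Bool)

/-- **The `TS`-valued homotopy datum of the sub-model setting** `nonarchGenuineMonoAnSub p P ψ` (all six arrows of
Def 5.4 (iii) restricted along `P.ι`). [cite: MochizukiAbsTopIII2015, Definition 5.4 (vii) p.128] -/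
noncomputable def nonarchGenuineMonoAnSubTS : (nonarchGenuineMonoAnSub p P ψ Vmod isArc).TSHomotopies where
  iota v _ _ ε := nonarchIotaTSSub p P (isArc v) ε
  iota_toTS v _ _ ε := nonarchIotaTSSub_toTS p P (isArc v) ε

/-- **The `TS`-valued homotopy datum of abc-iut-f-101's `genuineOpen p Vmod`** (the open-augmentation carrier, all places
nonarchimedean). [cite: MochizukiAbsTopIII2015, Definition 5.4 (vii) p.128] -/
noncomputable def genuineOpenTS : (genuineOpen p Vmod).TSHomotopies :=
  nonarchGenuineMonoAnSubTS p (TFModel.IsOpenAug (p := p)) MLFClosure.ψMonoPf Vmod (fun _ => false)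

/-! ## §2. The model lemmas: `IotaOverTS` at the sub-model settings and at `genuineOpen` -/

/-- Per-Boolean form of `nonarchGenuineMonoAnSubTS_iotaOverTS` (all edges of `Γ⃗^log_v`).
[cite: MochizukiAbsTopIII2015, Def 5.4 (vii) p. 128] -/
theorem nonarchGenuineMonoAnSubTS_iotaOverTS_aux (b : Bool) {ν₁ ν₂ : LogVertex b} (ε : LogEdgeTS b ν₁ ν₂) :
    Functor.whiskerRight (nonarchIotaTSSub p P b ε) (Up.liftF (CategoryTheory.Prod.fst P.FullSubcategory TSObj)) =
      (Functor.associator _ _ _).hom ≫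
        (Functor.associator _ _ _ ≪≫ Functor.isoWhiskerLeft _ (nonarchLamOverSub p P b ν₁) ≪≫
            (nonarchGenuineMonoAnSub p P ψ Vmod isArc).twistOver ν₁.isPostLog).hom ≫
          (nonarchLamOverSub p P b ν₂).inv ≫ (Functor.associator _ _ _).inv := by
  ext X₀
  cases b
  · cases ν₁ <;>
    · change (𝟙 X₀.down.obj ≫ 𝟙 X₀.down.obj : X₀.down.obj ⟶ X₀.down.obj) =
          𝟙 X₀.down.obj ≫ ((𝟙 X₀.down.obj ≫ (𝟙 X₀.down.obj ≫ 𝟙 X₀.down.obj)) ≫ (𝟙 X₀.down.obj ≫ 𝟙 X₀.down.obj))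
      simp
  · cases ν₁ <;>
    · change (𝟙 X₀.down.obj ≫ 𝟙 X₀.down.obj : X₀.down.obj ⟶ X₀.down.obj) =
          𝟙 X₀.down.obj ≫ ((𝟙 X₀.down.obj ≫ (𝟙 X₀.down.obj ≫ 𝟙 X₀.down.obj)) ≫ (𝟙 X₀.down.obj ≫ 𝟙 X₀.down.obj))
      simp

/-- **`IotaOverTS` HOLDS for the `TS` datum of every sub-model setting** (all six `TS`-valued arrows of Def 5.4 (iii),
including `k̄^× ↪ k̄`). [cite: MochizukiAbsTopIII2015, Def 5.4 (vii) p. 128] -/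
theorem nonarchGenuineMonoAnSubTS_iotaOverTS : (nonarchGenuineMonoAnSubTS p P ψ Vmod isArc).IotaOverTS :=
  fun v _ _ ε => nonarchGenuineMonoAnSubTS_iotaOverTS_aux p P ψ Vmod isArc (isArc v) ε

/-- ★ **`IotaOverTS` at the genuine open-augmentation carrier**, for its `TS` datum `genuineOpenTS` (brick D's hypothesis
(ιoverTS)). [cite: MochizukiAbsTopIII2015, Def 5.4 (vii) p. 128] -/
theorem genuineOpenTS_iotaOverTS : (genuineOpenTS p Vmod).IotaOverTS :=
  nonarchGenuineMonoAnSubTS_iotaOverTS p _ _ Vmod _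

/-- Consequence (abc-iut-L4-t3's `IotaOverTS.isIso_toE_iota` BY NAME): over `Th•[Z]` every `TS`-valued `ι_{v,ε}` of the
carrier is invertible — including the shell arrow (`log_k̄`, non-injective on `𝒪^×`) and `k̄^× ↪ k̄`, whose `TS`-components are
NOT invertible. [cite: MochizukiAbsTopIII2015, Def 5.4 (vii) p. 128] -/
theorem genuineOpenTS_isIso_toE_iota (v : Vmod) {ν₁ ν₂ : LogVertex false} (ε : LogEdgeTS false ν₁ ν₂)
    (X₀ : (genuineOpen p Vmod).X) :
    IsIso (((genuineOpen p Vmod).toE v).map (((genuineOpenTS p Vmod).iota v ε).app X₀)) :=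
  (genuineOpenTS_iotaOverTS p Vmod).isIso_toE_iota v ε X₀

end Sub

end LogFrobeniusSetting

end Literature.AnabelianGeometry.AbsoluteAnabelian
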